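import Summits.RiemannHypothesis.RiemannHypothesis.Theorems.ScrewLemmaKProfileBernoulliContinuation
import Summits.RiemannHypothesis.RiemannHypothesis.Theorems.ScrewLemmaKCoprofileZetaReflect
import Literature.Analysis.FunctionSpaces.PlancherelL1L2
import Summits.RiemannHypothesis.RiemannHypothesis.Theorems.ScrewLemmaKCoprofileSquareIntegrable
import Summits.RiemannHypothesis.RiemannHypothesis.Theorems.ScrewLemmaKCoprofileMellin

/-!
# Profile Parseval and the co-profile isometry K1 for `C²` data (K1 support; v5 §§7–8)

`∫₀¹ ψ²/y² + h₀² = (8π³)⁻¹ ∫_ℝ ‖G(−½+it)‖² ‖ζ(3/2+it)‖² dt` (Mellin–Plancherel at `σ = −½`, tree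
`Literature.Analysis.FunctionSpaces.integral_norm_sq_mellin_eq`; the profile Mellin formula of `…Continuation`; the
functional-equation modulus `ZetaReflect.norm_sq_zeta_neg_half_line`), and with the tree's co-profile Parseval
(`ScrewLemmaKCoprofile.latticeCoprofile_parseval_of_memLp`, item 22439): **`coprofileIsometry_C2`** —
`∫₀¹ ψ²/y² + h₀² = (4π²)⁻¹∫₀¹Φ_g²` for every `g ∈ C²[0,1]` with `g(1) = 0`, `∫g = 0`, and
`coprofileIsometry_of_admissible_C2` = the conclusion of item `CoprofileIsometry` VERBATIM for admissible `C²`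
generators (no `IntegrableOn` proviso needed).  The `C¹` case (the item as typed) follows by density
(`ScrewLemmaKCoprofileDensity{Approx,Limit}` + the closer).

Ported verbatim (tree conventions: docstrings, ≤ 400-line files) from rh-idea-5 g0's desk file
`pub/ideators/rh-idea-5/ProfileBernoulli.lean` v5 (sha16 4e6baba130239d85, lean check rc 0), in support of
item stmt-RiemannHypothesis-21612 `CoprofileIsometry` (K1 of route ScrewLemmaKCoprofile; shared with
ScrewLemmaKExtremalRay); §§1–3 are the tree's `ScrewLemmaKProfileBernoulli{,Defs,C2}` (k1-w3), §4 `…Muentz`.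
RH-free real/complex analysis: this is NOT a proof of RH and nothing here bears on the truth of RH.
-/

noncomputable section

set_option linter.dupNamespace false

namespace Summit.RiemannHypothesis.RiemannHypothesis.Theorems.IntegerScrew.ProfileBernoulli

open MeasureTheory Set intervalIntegral
open Summit.RiemannHypothesis.RiemannHypothesis.Theorems.IntegerScrew
open scoped BigOperators
open Summit.RiemannHypothesis.RiemannHypothesis.Theorems.SmoothSectorHardy (profileFun profileDev
  latticeProfile_eq_zero_of_one_lt latticeProfile_one)


/-! ## PROFILE PARSEVAL for `C²` data (K1, profile side)

`∫₀¹ ψ²/y² + h₀² = (8π³)⁻¹ ∫_ℝ ‖G(−½+it)‖² ‖ζ(3/2+it)‖² dt` — Mellin–Plancherel at `σ = −½`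
(tree `Literature.Analysis.FunctionSpaces.integral_norm_sq_mellin_eq`), the profile Mellin formula, and the
functional-equation modulus `‖ζ(−½+it)‖² = (¼+t²)(4π²)⁻¹‖ζ(3/2+it)‖²` (the factor `¼+t² = ‖−½+it‖²` cancels). -/

/-- `H = ψ·1_(0,1) − h₀·1_[1,∞)` pointwise. [folklore] -/
theorem profileFun_eq_psiInd_sub (g : ℝ → ℝ) (y : ℝ) :
    profileFun g y = psiInd g y - (((Ici (1:ℝ)).indicator (fun _ => latticePlateau g) y : ℝ) : ℂ) := by
  simp only [profileFun, psiInd, Complex.ofReal_sub]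

/-- `H` is measurable. [folklore] -/
theorem measurable_profileFun {g : ℝ → ℝ} (hC : ContDiffOn ℝ 1 g (Icc 0 1)) (h1 : g 1 = 0)
    (hI : ∫ u in (0:ℝ)..1, g u = 0) : Measurable (profileFun g) := by
  have : profileFun g = fun y => psiInd g y - (((Ici (1:ℝ)).indicator (fun _ => latticePlateau g) y : ℝ) : ℂ) :=
    funext fun y => profileFun_eq_psiInd_sub g y
  rw [this]
  exact (measurable_psiInd hC h1 hI).sub
    (Complex.measurable_ofReal.comp (measurable_const.indicator measurableSet_Ici))

/-- `‖H(y)‖ = |ψ(y)|` on `(0,1)`. [folklore] -/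
theorem norm_profileFun_of_mem_Ioo (g : ℝ → ℝ) {y : ℝ} (hy : y ∈ Ioo (0:ℝ) 1) :
    ‖profileFun g y‖ = |latticeProfile g y - latticePlateau g| := by
  have hy2 : y ∉ Ici (1:ℝ) := fun h => (not_lt.mpr h) hy.2
  simp only [profileFun, indicator_of_mem hy, indicator_of_notMem hy2, sub_zero, Complex.norm_real,
    Real.norm_eq_abs]

/-- `‖H(y)‖ = |h₀|` for `y ≥ 1`. [folklore] -/
theorem norm_profileFun_of_one_le (g : ℝ → ℝ) {y : ℝ} (hy : 1 ≤ y) :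
    ‖profileFun g y‖ = |latticePlateau g| := by
  have hy1 : y ∉ Ioo (0:ℝ) 1 := fun h => (not_lt.mpr hy) h.2
  have hy2 : y ∈ Ici (1:ℝ) := hy
  simp only [profileFun, indicator_of_notMem hy1, indicator_of_mem hy2, zero_sub, Complex.norm_real,
    Real.norm_eq_abs, abs_neg]

/-- weighted square-integrability `‖H‖² x⁻² ∈ L¹(0,∞)` for `C²` data. [folklore] -/
theorem integrableOn_norm_sq_profileFun {g : ℝ → ℝ} (hC2 : ContDiffOn ℝ 2 g (Icc 0 1)) (h1 : g 1 = 0)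
    (hI : ∫ u in (0:ℝ)..1, g u = 0) :
    IntegrableOn (fun x : ℝ => ‖profileFun g x‖ ^ 2 * x ^ (2 * (-(1 / 2) : ℝ) - 1)) (Ioi 0) := by
  have hC1 : ContDiffOn ℝ 1 g (Icc 0 1) := hC2.of_le (by norm_num)
  obtain ⟨C, hC0, hCy⟩ := exists_profile_sub_plateau_le_mul hC2 h1 hI
  have hexp : (2 * (-(1 / 2) : ℝ) - 1) = -2 := by norm_num
  rw [hexp]
  -- majorant
  set M : ℝ → ℝ := fun x => (Ioo (0:ℝ) 1).indicator (fun _ => C ^ 2) x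
      + (Ici (1:ℝ)).indicator (fun x => latticePlateau g ^ 2 * x ^ (-2:ℝ)) x with hM
  have hMint : IntegrableOn M (Ioi 0) := by
    apply IntegrableOn.add
    · exact ((integrableOn_const (measure_Ioo_lt_top (a := (0:ℝ)) (b := 1)).ne).integrable_indicator
        measurableSet_Ioo).integrableOn
    · have h0 : IntegrableOn (fun x : ℝ => latticePlateau g ^ 2 * x ^ (-2:ℝ)) (Ici (1:ℝ)) := by
        rw [integrableOn_congr_set_ae (Ioi_ae_eq_Ici (a := (1:ℝ))).symm]
        exact (integrableOn_Ioi_rpow_of_lt (by norm_num) zero_lt_one).const_mul _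
      exact (h0.integrable_indicator measurableSet_Ici).integrableOn
  have hmeas : AEStronglyMeasurable (fun x : ℝ => ‖profileFun g x‖ ^ 2 * x ^ (-2:ℝ))
      (volume.restrict (Ioi 0)) := by
    have : Measurable (fun x : ℝ => ‖profileFun g x‖ ^ 2 * x ^ (-2:ℝ)) :=
      ((measurable_profileFun hC1 h1 hI).norm.pow_const 2).mul (measurable_id.pow_const _)
    exact this.aestronglyMeasurable
  refine Integrable.mono' hMint hmeas ?_
  filter_upwards [ae_restrict_mem measurableSet_Ioi] with x hx
  have hx0 : (0:ℝ) < x := hx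
  rw [Real.norm_eq_abs, abs_of_nonneg (mul_nonneg (by positivity) (Real.rpow_nonneg hx0.le _))]
  by_cases hx1 : x < 1
  · have hxI : x ∈ Ioo (0:ℝ) 1 := ⟨hx0, hx1⟩
    have hxI' : x ∉ Ici (1:ℝ) := fun h => (not_lt.mpr h) hx1
    simp only [hM, indicator_of_mem hxI, indicator_of_notMem hxI', add_zero]
    rw [norm_profileFun_of_mem_Ioo g hxI]
    have hb := hCy x hx0
    have hx2 : x ^ (-2:ℝ) = 1 / x ^ 2 := by
      rw [Real.rpow_neg hx0.le, one_div]; norm_cast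
    rw [hx2]
    have habs : |latticeProfile g x - latticePlateau g| ^ 2 ≤ (C * x) ^ 2 :=
      pow_le_pow_left₀ (abs_nonneg _) hb 2
    calc |latticeProfile g x - latticePlateau g| ^ 2 * (1 / x ^ 2)
        ≤ (C * x) ^ 2 * (1 / x ^ 2) := by gcongr
      _ = C ^ 2 := by field_simp
  · have hx1' : 1 ≤ x := not_lt.mp hx1
    have hxI : x ∉ Ioo (0:ℝ) 1 := fun h => hx1 h.2
    have hxI' : x ∈ Ici (1:ℝ) := hx1'
    simp only [hM, indicator_of_notMem hxI, indicator_of_mem hxI', zero_add]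
    rw [norm_profileFun_of_one_le g hx1', sq_abs]

/-- the weighted norm integral splits as `∫₀¹ ψ²/y² + h₀²`. [folklore] -/
theorem integral_norm_sq_profileFun {g : ℝ → ℝ} (hC2 : ContDiffOn ℝ 2 g (Icc 0 1)) (h1 : g 1 = 0)
    (hI : ∫ u in (0:ℝ)..1, g u = 0) :
    (∫ x in Ioi (0:ℝ), ‖profileFun g x‖ ^ 2 * x ^ (2 * (-(1 / 2) : ℝ) - 1))
      = (∫ y in Ioo (0:ℝ) 1, (latticeProfile g y - latticePlateau g) ^ 2 / y ^ 2) + latticePlateau g ^ 2 := by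
  have hint := integrableOn_norm_sq_profileFun hC2 h1 hI
  have hexp : (2 * (-(1 / 2) : ℝ) - 1) = -2 := by norm_num
  rw [hexp] at hint ⊢
  rw [← Ioo_union_Ici_eq_Ioi zero_lt_one] at hint ⊢
  have hdisj : Disjoint (Ioo (0:ℝ) 1) (Ici 1) :=
    Set.disjoint_left.mpr fun x hx hx' => (not_le.mpr hx.2) (Set.mem_Ici.mp hx')
  rw [setIntegral_union hdisj measurableSet_Ici
    (hint.mono_set subset_union_left) (hint.mono_set subset_union_right)]
  congr 1
  · refine setIntegral_congr_fun measurableSet_Ioo fun x hx => ?_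
    simp only [norm_profileFun_of_mem_Ioo g hx, sq_abs]
    rw [Real.rpow_neg hx.1.le, div_eq_mul_inv]; norm_cast
  · have e : EqOn (fun x : ℝ => ‖profileFun g x‖ ^ 2 * x ^ (-2:ℝ))
        (fun x : ℝ => latticePlateau g ^ 2 * x ^ (-2:ℝ)) (Ici (1:ℝ)) := fun x hx => by
      simp only [norm_profileFun_of_one_le g (Set.mem_Ici.mp hx), sq_abs]
    rw [setIntegral_congr_fun measurableSet_Ici e, MeasureTheory.integral_const_mul,
      setIntegral_congr_set (Ioi_ae_eq_Ici (a := (1:ℝ))).symm,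
      integral_Ioi_rpow_of_lt (by norm_num) zero_lt_one]
    norm_num

/-- pointwise: `‖𝓜H(−½+iτ)‖² = ‖G(−½+iτ)·ζ(3/2+iτ)‖²/(4π²)` for `C²` data. [folklore] -/
theorem norm_sq_mellin_profileFun {g : ℝ → ℝ} (hC2 : ContDiffOn ℝ 2 g (Icc 0 1)) (h1 : g 1 = 0)
    (hI : ∫ u in (0:ℝ)..1, g u = 0) (τ : ℝ) :
    ‖mellin (profileFun g) (-(1 / 2 : ℂ) + τ * Complex.I)‖ ^ 2
      = (1 / (4 * Real.pi ^ 2)) * ‖(∫ u in Ioo (0:ℝ) 1, ((deriv g u : ℝ) : ℂ) * (u : ℂ) ^ (-(1 / 2 : ℂ) + τ * Complex.I))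
          * riemannZeta (3 / 2 + τ * Complex.I)‖ ^ 2 := by
  rw [mellin_profileFun_eq hC2 h1 hI (by norm_num) (by norm_num)]
  have hw0 : (-(1 / 2 : ℂ) + τ * Complex.I) ≠ 0 := by
    intro h; have := congrArg Complex.re h; simp at this
  have hnw : ‖(-(1 / 2 : ℂ) + τ * Complex.I)‖ ^ 2 = 1 / 4 + τ ^ 2 := by
    rw [Complex.sq_norm, Complex.normSq_apply]; simp; ring
  have hz := ZetaReflect.norm_sq_zeta_neg_half_line τ
  rw [norm_mul, norm_neg, norm_div, mul_pow, div_pow, hz, hnw, norm_mul, mul_pow]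
  have hq : (1 / 4 + τ ^ 2 : ℝ) ≠ 0 := by positivity
  field_simp

/-- PROFILE PARSEVAL (`C²` data). [folklore] -/
theorem profile_parseval_C2 {g : ℝ → ℝ} (hC2 : ContDiffOn ℝ 2 g (Icc 0 1)) (h1 : g 1 = 0)
    (hI : ∫ u in (0:ℝ)..1, g u = 0) :
    (∫ y in Ioo (0:ℝ) 1, (latticeProfile g y - latticePlateau g) ^ 2 / y ^ 2) + latticePlateau g ^ 2
      = (1 / (8 * Real.pi ^ 3)) * ∫ τ : ℝ, ‖(∫ u in Ioo (0:ℝ) 1, ((deriv g u : ℝ) : ℂ)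
          * (u : ℂ) ^ (-(1 / 2 : ℂ) + τ * Complex.I)) * riemannZeta (3 / 2 + τ * Complex.I)‖ ^ 2 := by
  have hconv : MellinConvergent (profileFun g) (((-(1 / 2) : ℝ) : ℂ)) :=
    mellinConvergent_profileFun hC2 h1 hI (by simp; norm_num) (by simp)
  obtain ⟨_, hP⟩ := Literature.Analysis.FunctionSpaces.integral_norm_sq_mellin_eq hconv
    (integrableOn_norm_sq_profileFun hC2 h1 hI)
  have e : ∀ τ : ℝ, (((-(1 / 2) : ℝ) : ℂ) + τ * Complex.I) = -(1 / 2 : ℂ) + τ * Complex.I := fun τ => by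
    push_cast; ring
  simp_rw [e] at hP
  rw [integral_norm_sq_profileFun hC2 h1 hI] at hP
  simp_rw [norm_sq_mellin_profileFun hC2 h1 hI] at hP
  rw [MeasureTheory.integral_const_mul] at hP
  have hpi : Real.pi ≠ 0 := Real.pi_ne_zero
  -- hP : (1/(4π²)) X = 2π L
  set L := (∫ y in Ioo (0:ℝ) 1, (latticeProfile g y - latticePlateau g) ^ 2 / y ^ 2) + latticePlateau g ^ 2
    with hL
  set X := ∫ τ : ℝ, ‖(∫ u in Ioo (0:ℝ) 1, ((deriv g u : ℝ) : ℂ) * (u : ℂ) ^ (-(1 / 2 : ℂ) + τ * Complex.I))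
    * riemannZeta (3 / 2 + τ * Complex.I)‖ ^ 2 with hX
  calc L = (1 / (2 * Real.pi)) * (2 * Real.pi * L) := by field_simp
    _ = (1 / (2 * Real.pi)) * ((1 / (4 * Real.pi ^ 2)) * X) := by rw [← hP]
    _ = (1 / (8 * Real.pi ^ 3)) * X := by ring


/-! ## K1 (`CoprofileIsometry`) for `C²` data

Profile Parseval (above) + the tree's co-profile Parseval
(`Theorems.ScrewLemmaKCoprofile.latticeCoprofile_parseval_of_memLp`, item 22439, needs only `g ∈ C¹`):
`∫₀¹ ψ²/y² + h₀² = (4π²)⁻¹ ∫₀¹ Φ_g²` for every `g ∈ C²[0,1]` with `g(1) = 0`, `∫g = 0`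
(the `u^{-1/2}`-moment condition of admissibility is NOT used). -/

/-- **K1 for `C²` data**: `∫₀¹ ψ²/y² + h₀² = (4π²)⁻¹ ∫₀¹ Φ_g²` for `g ∈ C²[0,1]`, `g(1) = 0`, `∫g = 0`. [folklore] -/
theorem coprofileIsometry_C2 {g : ℝ → ℝ} (hC2 : ContDiffOn ℝ 2 g (Icc 0 1)) (h1 : g 1 = 0)
    (hI : ∫ u in (0:ℝ)..1, g u = 0) :
    (∫ y in Ioo (0:ℝ) 1, (latticeProfile g y - latticePlateau g) ^ 2 / y ^ 2) + latticePlateau g ^ 2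
      = (1 / (4 * Real.pi ^ 2))
        * ∫ t in Ioo (0:ℝ) 1, (∑ n ∈ Finset.Icc 1 ⌊1 / t⌋₊, deriv g (n * t) / n) ^ 2 := by
  have hC1 : ContDiffOn ℝ 1 g (Icc 0 1) := hC2.of_le (by norm_num)
  obtain ⟨B, hB⟩ :=
    Summit.RiemannHypothesis.RiemannHypothesis.Theorems.ScrewLemmaKCoprofile.exists_bound_deriv_Ioo hC1
  have hcp := Summit.RiemannHypothesis.RiemannHypothesis.Theorems.ScrewLemmaKCoprofile.latticeCoprofile_parseval_of_memLp
    hB (Summit.RiemannHypothesis.RiemannHypothesis.Theorems.ScrewLemmaKCoprofile.memLp_two_latticeCoprofile hC1)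
  have e : (∫ t in Ioo (0:ℝ) 1, (∑ n ∈ Finset.Icc 1 ⌊1 / t⌋₊, deriv g (n * t) / n) ^ 2)
      = ∫ t in Ioo (0:ℝ) 1,
        (Summit.RiemannHypothesis.RiemannHypothesis.Theorems.ScrewLemmaKCoprofile.latticeCoprofile g t) ^ 2 := rfl
  rw [profile_parseval_C2 hC2 h1 hI, e, hcp]
  simp_rw [norm_mul, mul_pow]
  have hpi : Real.pi ≠ 0 := Real.pi_ne_zero
  set X := ∫ τ : ℝ, ‖∫ u in Ioo (0:ℝ) 1, ((deriv g u : ℝ) : ℂ) * (u : ℂ) ^ (-(1 / 2 : ℂ) + τ * Complex.I)‖ ^ 2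
    * ‖riemannZeta (3 / 2 + τ * Complex.I)‖ ^ 2 with hX
  field_simp
  ring

/-- The same for an admissible generator of class `C²` — item `ScrewLemmaKCoprofile.CoprofileIsometry`
(stmt-RiemannHypothesis-21612) RESTRICTED to `C²` data; its `IntegrableOn` proviso is not needed. [folklore] -/
theorem coprofileIsometry_of_admissible_C2 {g : ℝ → ℝ} (hg : SmoothSectorAdmissible g)
    (hC2 : ContDiffOn ℝ 2 g (Icc 0 1)) :
    (∫ y in Set.Ioo (0:ℝ) 1, (latticeProfile g y - latticePlateau g) ^ 2 / y ^ 2) + latticePlateau g ^ 2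
      = (1 / (4 * Real.pi ^ 2))
        * ∫ t in Set.Ioo (0:ℝ) 1, (∑ n ∈ Finset.Icc 1 ⌊1 / t⌋₊, deriv g (n * t) / n) ^ 2 :=
  coprofileIsometry_C2 hC2 hg.2.1 hg.2.2.1

end Summit.RiemannHypothesis.RiemannHypothesis.Theorems.IntegerScrew.ProfileBernoulli

end
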